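import Mathlib.Analysis.Calculus.LineDeriv.IntegrationByParts
import Mathlib.Analysis.Calculus.FDeriv.Pow
import Mathlib.Analysis.Calculus.Deriv.Slope
import Mathlib.Analysis.InnerProductSpace.Calculus
import Mathlib.Analysis.InnerProductSpace.PiL2
import Mathlib.Analysis.SpecialFunctions.SmoothTransition
import Mathlib.MeasureTheory.Integral.Bochner.Basic
import HarnessLib

/-!
# Hardy's inequality in the exterior of a ball:
# `∫_{‖y‖ > R} u²/‖y‖² ≤ (2/(n − 2))² ∫_{‖y‖ > R} ‖Du‖²` (`n ≥ 3`, `R > 0`)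

(namespace `Literature.Analysis.Calculus`; companion of `HardyHalfLine.lean` and
`HardyLogarithmic.lean`)

Dafermos–Rodnianski–Shlapentokh-Rothman (*Decay for solutions of the wave equation on Kerr
exterior spacetimes III*, arXiv:1402.7034 = Ann. of Math. 183 (2016), §4.3) record two
one-dimensional Hardy inequalities and remark that "in view of our comments concerning the volume
form, the reader can easily derive" from them the Hardy inequalities on the hypersurfaces `Σ_τ`
used throughout their argument (zeroth-order terms at large `r`: Prop. 4.6.1, §§9.2, 9.6).
In the Cartesian Kerr–Schild coordinates of this tree the slices are copies of `ℝ³` with the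
Euclidean volume, and the derived statement at large `r` is the classical Hardy inequality of
`ℝⁿ`, `n ≥ 3`, outside a ball. This file **proves** it, for a real finite-dimensional inner
product space `E` of dimension `n ≥ 3` with its Lebesgue measure, `u ∈ C¹_c(E)` and `R > 0`:

  `∫_{‖y‖ > R} u(y)²/‖y‖² dy ≤ (2/(n − 2))² ∫_{‖y‖ > R} ‖Du(y)‖² dy`

(`hardy_sq_integral_exterior_le`; for `n = 3` the constant is `4`, and `‖Du(y)‖` is the operator
norm of the differential, `= |∇u(y)|`). No boundary term appears because the boundary
contribution `−R⁻¹ ∫_{‖y‖ = R} u²` of the radial integration by parts has the favourable sign, as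
in the half-line inequality `∫₁^∞ f² ≤ 4 ∫₁^∞ x² (f')²` of `HardyHalfLine.lean`.

## Proof (radial integration by parts with a cut-off, no spherical coordinates)

For `Θ ∈ C¹_c(E)` one has the Euler identity `∫ DΘ(y)[y] dy = −n ∫ Θ`
(`integral_fderiv_apply_self_eq`: expand `y = ∑ᵢ ⟪bᵢ, y⟫ bᵢ` in an orthonormal basis and
integrate by parts in each coordinate, Mathlib's
`integral_mul_fderiv_eq_neg_fderiv_mul_of_integrable`). Apply it to
`Θ = θ(‖y‖²) u²`, `θ(s) = η(s)/s`, where `η ∈ C¹(ℝ)` is nondecreasing and vanishes on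
`(−∞, R²]` (so `θ ∈ C¹`, and no singularity at the origin occurs): with `N = ‖y‖²`,
`DΘ[y] = 2(η'(N) − θ(N)) u² + 2 θ(N) u Du[y]`, whence
`(n − 2) ∫ θ(N) u² = −2 ∫ η'(N) u² − 2 ∫ θ(N) u Du[y] ≤ 2 ∫ θ(N) |u| ‖Du‖ ‖y‖`, and
`2 θ(N)|u| ‖Du‖ ‖y‖ ≤ ((n−2)/2) θ(N) u² + (2/(n−2)) η(N) ‖Du‖²` gives
`∫ η(N) u²/N ≤ (2/(n−2))² ∫ η(N) ‖Du‖²` (`hardy_sq_integral_cutoff_le`). Finally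
`η_k(s) = smoothTransition((k+1)(s − R²))` takes values in `[0, 1]`, vanishes for `s ≤ R²` and
increases to `1_{s > R²}`, so the right side is at most the exterior integral and the left side
converges to it (monotone convergence).

Mathlib has no Hardy inequality (1-D or `ℝⁿ`); the `ℝⁿ` statement is classical ("Hardy's
inequality", "uncertainty principle lemma" for `n = 3`). Everything below is proved; no named
facts.

## References

* M. Dafermos, I. Rodnianski, Y. Shlapentokh-Rothman, arXiv:1402.7034 = Ann. of Math. 183 (2016),
  §4.3 (key `DafermosRodnianskiShlapentokhrothman2014`).
* M. Dafermos, I. Rodnianski, arXiv:1010.5132, §4.3 (key `DafermosRodnianski2010KerrSmallA`).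
-/

noncomputable section

open MeasureTheory Set Filter Module
open scoped Topology RealInnerProductSpace

namespace Literature.Analysis.Calculus

variable {E : Type*} [NormedAddCommGroup E] [InnerProductSpace ℝ E] [FiniteDimensional ℝ E]
  [MeasurableSpace E] [BorelSpace E]

/-! ### The Euler identity `∫ DΘ(y)[y] dy = −n ∫ Θ` -/

/-- **Euler identity.** For `Θ ∈ C¹_c(E)`, `∫ DΘ(y)[y] dy = −(dim E) ∫ Θ(y) dy`
(integration by parts of `∑ᵢ yᵢ ∂ᵢΘ` coordinate by coordinate; no boundary terms). [folklore] -/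
theorem integral_fderiv_apply_self_eq {Θ : E → ℝ} (hΘ : ContDiff ℝ 1 Θ)
    (hc : HasCompactSupport Θ) :
    ∫ y, fderiv ℝ Θ y y = -(finrank ℝ E : ℝ) * ∫ y, Θ y := by
  set b := stdOrthonormalBasis ℝ E with hb
  have hΘc : Continuous Θ := hΘ.continuous
  have hDc : Continuous (fderiv ℝ Θ) := hΘ.continuous_fderiv one_ne_zero
  -- expand `y` in the orthonormal basis
  have hexp : ∀ y, fderiv ℝ Θ y y = ∑ i, ⟪b i, y⟫ * fderiv ℝ Θ y (b i) := by
    intro y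
    have h := congrArg (fderiv ℝ Θ y) (b.sum_repr' y).symm
    rw [h, map_sum]
    simp only [map_smul, smul_eq_mul]
  -- integrability of the coordinate terms
  have hint : ∀ i, Integrable (fun y ↦ ⟪b i, y⟫ * fderiv ℝ Θ y (b i)) := by
    intro i
    refine Continuous.integrable_of_hasCompactSupport
      ((continuous_const.inner continuous_id).mul (hDc.clm_apply continuous_const)) ?_
    exact (hc.fderiv_apply (𝕜 := ℝ) (b i)).mul_left
  -- each coordinate term integrates to `−∫ Θ`
  have hterm : ∀ i, ∫ y, ⟪b i, y⟫ * fderiv ℝ Θ y (b i) = -∫ y, Θ y := by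
    intro i
    have hfe : (fun y : E ↦ ⟪b i, y⟫) = innerSL ℝ (b i) := by
      ext y
      simp
    have h1 : ∀ y, fderiv ℝ (fun y : E ↦ ⟪b i, y⟫) y (b i) = 1 := by
      intro y
      rw [hfe, ContinuousLinearMap.fderiv, innerSL_apply_apply, real_inner_self_eq_norm_sq,
        b.orthonormal.1 i, one_pow]
    have key := integral_mul_fderiv_eq_neg_fderiv_mul_of_integrable (μ := volume)
      (f := fun y : E ↦ ⟪b i, y⟫) (g := Θ) (v := b i) ?_ (hint i) ?_ ?_ ?_
    · rw [key]
      congr 1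
      refine integral_congr_ae (ae_of_all _ fun y ↦ ?_)
      simp only [h1 y, one_mul]
    · simp only [h1, one_mul]
      exact hΘc.integrable_of_hasCompactSupport hc
    · exact ((continuous_const.inner continuous_id).mul hΘc).integrable_of_hasCompactSupport
        hc.mul_left
    · intro x _
      rw [hfe]
      exact (innerSL ℝ (b i)).differentiableAt
    · intro x _
      exact hΘ.differentiable one_ne_zero x
  calc ∫ y, fderiv ℝ Θ y y = ∫ y, ∑ i, ⟪b i, y⟫ * fderiv ℝ Θ y (b i) := by simp_rw [hexp]
    _ = ∑ i, ∫ y, ⟪b i, y⟫ * fderiv ℝ Θ y (b i) := integral_finsetSum _ fun i _ ↦ hint i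
    _ = ∑ _i : Fin (finrank ℝ E), -∫ y, Θ y := by simp_rw [hterm]
    _ = -(finrank ℝ E : ℝ) * ∫ y, Θ y := by
      simp only [Finset.sum_const, Finset.card_univ, Fintype.card_fin]
      ring

/-! ### The cut-off weight `θ(s) = η(s)/s` -/

/-- If `η ∈ C¹(ℝ)` vanishes on `(−∞, R²]` with `R ≠ 0`, then `s ↦ η(s)/s` is `C¹` on `ℝ`.
[folklore] -/
theorem contDiff_div_id_of_eq_zero {η : ℝ → ℝ} (hη : ContDiff ℝ 1 η) {R : ℝ} (hR : R ≠ 0)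
    (hη0 : ∀ s ≤ R ^ 2, η s = 0) : ContDiff ℝ 1 fun s ↦ η s / s := by
  rw [contDiff_iff_contDiffAt]
  intro s
  by_cases hs : s < R ^ 2
  · have : (fun s ↦ η s / s) =ᶠ[𝓝 s] fun _ ↦ (0 : ℝ) := by
      filter_upwards [Iio_mem_nhds hs] with t ht
      simp [hη0 t (le_of_lt ht)]
    exact contDiffAt_const.congr_of_eventuallyEq this
  · have hs0 : s ≠ 0 := by
      intro h
      exact hs (h ▸ by positivity)
    exact hη.contDiffAt.div contDiffAt_id hs0

/-- For such `η`, `s · (η(s)/s)' = η'(s) − η(s)/s` for every `s`. [folklore] -/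
theorem mul_deriv_div_id_eq {η : ℝ → ℝ} (hη : ContDiff ℝ 1 η) {R : ℝ} (hR : R ≠ 0)
    (hη0 : ∀ s ≤ R ^ 2, η s = 0) (s : ℝ) :
    s * deriv (fun s ↦ η s / s) s = deriv η s - η s / s := by
  by_cases hs : s < R ^ 2
  · have h1 : (fun s ↦ η s / s) =ᶠ[𝓝 s] fun _ ↦ (0 : ℝ) := by
      filter_upwards [Iio_mem_nhds hs] with t ht
      simp [hη0 t (le_of_lt ht)]
    have h2 : η =ᶠ[𝓝 s] fun _ ↦ (0 : ℝ) := by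
      filter_upwards [Iio_mem_nhds hs] with t ht
      exact hη0 t (le_of_lt ht)
    rw [h1.deriv_eq, h2.deriv_eq]
    simp [hη0 s hs.le]
  · have hs0 : s ≠ 0 := by
      intro h
      exact hs (h ▸ by positivity)
    have hd : HasDerivAt (fun s ↦ η s / s) ((deriv η s * s - η s * 1) / s ^ 2) s :=
      ((hη.differentiable one_ne_zero s).hasDerivAt).div (hasDerivAt_id s) hs0
    rw [hd.deriv]
    field_simp

/-! ### The inequality with a cut-off -/

/-- **Hardy's inequality with a radial cut-off.** Let `dim E = n > 2`, `u ∈ C¹_c(E)`, `R ≠ 0`,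
and let `η ∈ C¹(ℝ)` be nondecreasing and vanish on `(−∞, R²]`. Then
`∫ η(‖y‖²) u²/‖y‖² ≤ (2/(n − 2))² ∫ η(‖y‖²) ‖Du‖²`. [folklore] -/
theorem hardy_sq_integral_cutoff_le {u : E → ℝ} (hu : ContDiff ℝ 1 u) (hc : HasCompactSupport u)
    {R : ℝ} (hR : R ≠ 0) {η : ℝ → ℝ} (hη : ContDiff ℝ 1 η) (hηm : Monotone η)
    (hη0 : ∀ s ≤ R ^ 2, η s = 0) (hn : 2 < (finrank ℝ E : ℝ)) :
    ∫ y, η (‖y‖ ^ 2) * u y ^ 2 / ‖y‖ ^ 2 ≤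
      (2 / ((finrank ℝ E : ℝ) - 2)) ^ 2 * ∫ y, η (‖y‖ ^ 2) * ‖fderiv ℝ u y‖ ^ 2 := by
  set n : ℝ := (finrank ℝ E : ℝ) with hn'
  set θ : ℝ → ℝ := fun s ↦ η s / s with hθ
  have hθC : ContDiff ℝ 1 θ := contDiff_div_id_of_eq_zero hη hR hη0
  have hθ' : ∀ s, s * deriv θ s = deriv η s - θ s := mul_deriv_div_id_eq hη hR hη0
  have hηnn : ∀ s, 0 ≤ η s := by
    intro s
    rcases le_or_gt s (R ^ 2) with hs | hs
    · exact (hη0 s hs).ge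
    · simpa [hη0 (R ^ 2) le_rfl] using hηm hs.le
  have hθnn : ∀ s, 0 ≤ θ s := by
    intro s
    rcases le_or_gt s 0 with hs | hs
    · simp [hθ, hη0 s (hs.trans (sq_nonneg R))]
    · exact div_nonneg (hηnn s) hs.le
  have hθs : ∀ s, θ s * s = η s := by
    intro s
    rcases eq_or_ne s 0 with rfl | hs
    · simp [hθ, hη0 0 (sq_nonneg R)]
    · simp only [hθ]
      field_simp
  have hη' : ∀ s, 0 ≤ deriv η s := fun s ↦ hηm.deriv_nonneg
  -- continuity facts
  have huc : Continuous u := hu.continuous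
  have hDc : Continuous (fderiv ℝ u) := hu.continuous_fderiv one_ne_zero
  have hNc : Continuous fun y : E ↦ ‖y‖ ^ 2 := (continuous_norm).pow 2
  have hθNc : Continuous fun y : E ↦ θ (‖y‖ ^ 2) := hθC.continuous.comp hNc
  have hη'Nc : Continuous fun y : E ↦ deriv η (‖y‖ ^ 2) := hη.continuous_deriv_one.comp hNc
  have hηNc : Continuous fun y : E ↦ η (‖y‖ ^ 2) := hη.continuous.comp hNc
  -- everything below is supported in `tsupport u`
  have hK : IsCompact (tsupport u) := hc
  have hz : ∀ y ∉ tsupport u, u y = 0 := fun y hy ↦ image_eq_zero_of_notMem_tsupport hy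
  have hDz : ∀ y ∉ tsupport u, fderiv ℝ u y = 0 := fun y hy ↦ fderiv_of_notMem_tsupport ℝ hy
  have hcs : ∀ {φ : E → ℝ}, (∀ y ∉ tsupport u, φ y = 0) → HasCompactSupport φ :=
    fun h ↦ HasCompactSupport.intro hK h
  -- the test function `Θ = θ(‖y‖²) u²`
  have hΘC : ContDiff ℝ 1 fun y : E ↦ θ (‖y‖ ^ 2) * u y ^ 2 :=
    (hθC.comp (contDiff_norm_sq ℝ)).mul (hu.pow 2)
  have hΘc : HasCompactSupport fun y : E ↦ θ (‖y‖ ^ 2) * u y ^ 2 :=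
    hcs fun y hy ↦ by simp [hz y hy]
  -- its derivative along `y`
  have hDΘ : ∀ y, fderiv ℝ (fun y : E ↦ θ (‖y‖ ^ 2) * u y ^ 2) y y =
      2 * (deriv η (‖y‖ ^ 2) - θ (‖y‖ ^ 2)) * u y ^ 2 +
        2 * θ (‖y‖ ^ 2) * u y * fderiv ℝ u y y := by
    intro y
    have hN : HasFDerivAt (fun y : E ↦ ‖y‖ ^ 2) (2 • innerSL ℝ y) y :=
      (hasStrictFDerivAt_norm_sq y).hasFDerivAt
    have h1 : HasFDerivAt (fun y : E ↦ θ (‖y‖ ^ 2)) (deriv θ (‖y‖ ^ 2) • (2 • innerSL ℝ y)) y :=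
      ((hθC.differentiable one_ne_zero _).hasDerivAt).comp_hasFDerivAt y hN
    have h2 : HasFDerivAt (fun y ↦ u y ^ 2) ((2 • u y ^ (2 - 1)) • fderiv ℝ u y) y :=
      ((hu.differentiable one_ne_zero y).hasFDerivAt).pow 2
    have h3 : HasFDerivAt (fun y : E ↦ θ (‖y‖ ^ 2) * u y ^ 2)
        (θ (‖y‖ ^ 2) • ((2 • u y ^ (2 - 1)) • fderiv ℝ u y) +
          u y ^ 2 • (deriv θ (‖y‖ ^ 2) • (2 • innerSL ℝ y))) y := h1.mul h2
    rw [h3.fderiv]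
    simp only [_root_.add_apply, _root_.smul_apply, smul_eq_mul, innerSL_apply_apply,
      real_inner_self_eq_norm_sq]
    norm_num
    linear_combination (2 * u y ^ 2) * hθ' (‖y‖ ^ 2)
  -- the Euler identity for `Θ`
  have hEuler := integral_fderiv_apply_self_eq hΘC hΘc
  -- integrability of the pieces (continuous, compactly supported)
  have hIA : Integrable fun y : E ↦ deriv η (‖y‖ ^ 2) * u y ^ 2 :=
    (hη'Nc.mul (huc.pow 2)).integrable_of_hasCompactSupport (hcs fun y hy ↦ by simp [hz y hy])
  have hII : Integrable fun y : E ↦ θ (‖y‖ ^ 2) * u y ^ 2 :=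
    (hθNc.mul (huc.pow 2)).integrable_of_hasCompactSupport (hcs fun y hy ↦ by simp [hz y hy])
  have hIK : Integrable fun y : E ↦ θ (‖y‖ ^ 2) * u y * fderiv ℝ u y y :=
    ((hθNc.mul huc).mul (hDc.clm_apply continuous_id)).integrable_of_hasCompactSupport
      (hcs fun y hy ↦ by simp [hz y hy])
  have hIJ : Integrable fun y : E ↦ η (‖y‖ ^ 2) * ‖fderiv ℝ u y‖ ^ 2 :=
    (hηNc.mul ((continuous_norm.comp hDc).pow 2)).integrable_of_hasCompactSupport
      (hcs fun y hy ↦ by simp [hDz y hy])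
  -- `(n − 2) I = −2A − 2K`
  have hid : (n - 2) * (∫ y : E, θ (‖y‖ ^ 2) * u y ^ 2) =
      -2 * (∫ y : E, deriv η (‖y‖ ^ 2) * u y ^ 2) -
        2 * ∫ y : E, θ (‖y‖ ^ 2) * u y * fderiv ℝ u y y := by
    have e1 : ∫ y, fderiv ℝ (fun y : E ↦ θ (‖y‖ ^ 2) * u y ^ 2) y y =
        2 * (∫ y : E, deriv η (‖y‖ ^ 2) * u y ^ 2) - 2 * (∫ y : E, θ (‖y‖ ^ 2) * u y ^ 2) +
          2 * ∫ y : E, θ (‖y‖ ^ 2) * u y * fderiv ℝ u y y := by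
      have : (fun y ↦ fderiv ℝ (fun y : E ↦ θ (‖y‖ ^ 2) * u y ^ 2) y y) = fun y ↦
          (2 * (deriv η (‖y‖ ^ 2) * u y ^ 2) - 2 * (θ (‖y‖ ^ 2) * u y ^ 2)) +
            2 * (θ (‖y‖ ^ 2) * u y * fderiv ℝ u y y) := by
        funext y
        rw [hDΘ y]
        ring
      have i1 : Integrable fun y : E ↦
          2 * (deriv η (‖y‖ ^ 2) * u y ^ 2) - 2 * (θ (‖y‖ ^ 2) * u y ^ 2) :=
        (hIA.const_mul 2).sub (hII.const_mul 2)
      have i2 : Integrable fun y : E ↦ 2 * (θ (‖y‖ ^ 2) * u y * fderiv ℝ u y y) :=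
        hIK.const_mul 2
      rw [this, integral_add i1 i2, integral_sub (hIA.const_mul 2) (hII.const_mul 2),
        integral_const_mul, integral_const_mul, integral_const_mul]
    rw [e1] at hEuler
    linarith
  have hA0 : 0 ≤ ∫ y : E, deriv η (‖y‖ ^ 2) * u y ^ 2 :=
    integral_nonneg fun y ↦ mul_nonneg (hη' _) (sq_nonneg _)
  -- `−2K ≤ c I + J / c` with `c = (n − 2)/2`
  obtain ⟨c, hc'⟩ : ∃ c : ℝ, c = (n - 2) / 2 := ⟨_, rfl⟩
  have hcpos : 0 < c := by
    rw [hc']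
    linarith
  have hpt : ∀ y, -(2 * (θ (‖y‖ ^ 2) * u y * fderiv ℝ u y y)) ≤
      c * (θ (‖y‖ ^ 2) * u y ^ 2) + c⁻¹ * (η (‖y‖ ^ 2) * ‖fderiv ℝ u y‖ ^ 2) := by
    intro y
    have hθy := hθnn (‖y‖ ^ 2)
    have hop : |fderiv ℝ u y y| ≤ ‖fderiv ℝ u y‖ * ‖y‖ := by
      simpa [Real.norm_eq_abs] using (fderiv ℝ u y).le_opNorm y
    -- `2 θ |u| |Du y| ≤ 2 θ |u| ‖Du‖ ‖y‖ ≤ θ (c u² + ‖Du‖² ‖y‖² / c)` and `θ ‖y‖² = η`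
    have h1 : -(2 * (θ (‖y‖ ^ 2) * u y * fderiv ℝ u y y)) ≤
        2 * θ (‖y‖ ^ 2) * (|u y| * (‖fderiv ℝ u y‖ * ‖y‖)) := by
      have : -(u y * fderiv ℝ u y y) ≤ |u y| * (‖fderiv ℝ u y‖ * ‖y‖) := by
        calc -(u y * fderiv ℝ u y y) ≤ |u y * fderiv ℝ u y y| := neg_le_abs _
          _ = |u y| * |fderiv ℝ u y y| := abs_mul _ _
          _ ≤ |u y| * (‖fderiv ℝ u y‖ * ‖y‖) := by gcongr
      nlinarith
    have h2 : 2 * (|u y| * (‖fderiv ℝ u y‖ * ‖y‖)) ≤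
        c * u y ^ 2 + c⁻¹ * (‖fderiv ℝ u y‖ ^ 2 * ‖y‖ ^ 2) := by
      have key : c * u y ^ 2 + c⁻¹ * (‖fderiv ℝ u y‖ ^ 2 * ‖y‖ ^ 2) -
          2 * (|u y| * (‖fderiv ℝ u y‖ * ‖y‖)) =
          c⁻¹ * (c * |u y| - ‖fderiv ℝ u y‖ * ‖y‖) ^ 2 := by
        rw [← sq_abs (u y)]
        field_simp
        ring
      have : 0 ≤ c⁻¹ * (c * |u y| - ‖fderiv ℝ u y‖ * ‖y‖) ^ 2 := by positivity
      linarith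
    have h3 : θ (‖y‖ ^ 2) * (c⁻¹ * (‖fderiv ℝ u y‖ ^ 2 * ‖y‖ ^ 2)) =
        c⁻¹ * (η (‖y‖ ^ 2) * ‖fderiv ℝ u y‖ ^ 2) := by
      rw [← hθs (‖y‖ ^ 2)]
      ring
    calc -(2 * (θ (‖y‖ ^ 2) * u y * fderiv ℝ u y y))
        ≤ 2 * θ (‖y‖ ^ 2) * (|u y| * (‖fderiv ℝ u y‖ * ‖y‖)) := h1
      _ = θ (‖y‖ ^ 2) * (2 * (|u y| * (‖fderiv ℝ u y‖ * ‖y‖))) := by ring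
      _ ≤ θ (‖y‖ ^ 2) * (c * u y ^ 2 + c⁻¹ * (‖fderiv ℝ u y‖ ^ 2 * ‖y‖ ^ 2)) :=
          mul_le_mul_of_nonneg_left h2 hθy
      _ = c * (θ (‖y‖ ^ 2) * u y ^ 2) + c⁻¹ * (η (‖y‖ ^ 2) * ‖fderiv ℝ u y‖ ^ 2) := by
          rw [mul_add, h3]
          ring
  have hKb : -2 * (∫ y : E, θ (‖y‖ ^ 2) * u y * fderiv ℝ u y y) ≤
      c * (∫ y : E, θ (‖y‖ ^ 2) * u y ^ 2) + c⁻¹ * ∫ y : E, η (‖y‖ ^ 2) * ‖fderiv ℝ u y‖ ^ 2 := by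
    have i1 : Integrable fun y : E ↦ -(2 * (θ (‖y‖ ^ 2) * u y * fderiv ℝ u y y)) :=
      (hIK.const_mul 2).neg
    have i2 : Integrable fun y : E ↦
        c * (θ (‖y‖ ^ 2) * u y ^ 2) + c⁻¹ * (η (‖y‖ ^ 2) * ‖fderiv ℝ u y‖ ^ 2) :=
      (hII.const_mul c).add (hIJ.const_mul c⁻¹)
    have := integral_mono i1 i2 hpt
    rw [integral_neg, integral_const_mul, integral_add (hII.const_mul c) (hIJ.const_mul c⁻¹),
      integral_const_mul, integral_const_mul] at this
    linarith
  -- conclude: `(n − 2) I ≤ c I + J/c`, i.e. `I ≤ (2/(n−2))² J`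
  have hLHS : ∫ y, η (‖y‖ ^ 2) * u y ^ 2 / ‖y‖ ^ 2 = ∫ y : E, θ (‖y‖ ^ 2) * u y ^ 2 := by
    refine integral_congr_ae (ae_of_all _ fun y ↦ ?_)
    simp only [hθ]
    ring
  rw [hLHS]
  have hI : (n - 2) * (∫ y : E, θ (‖y‖ ^ 2) * u y ^ 2) ≤
      c * (∫ y : E, θ (‖y‖ ^ 2) * u y ^ 2) + c⁻¹ * ∫ y : E, η (‖y‖ ^ 2) * ‖fderiv ℝ u y‖ ^ 2 := by
    linarith
  have e : (2 / (n - 2)) ^ 2 * (∫ y : E, η (‖y‖ ^ 2) * ‖fderiv ℝ u y‖ ^ 2) =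
      c⁻¹ * (c⁻¹ * ∫ y : E, η (‖y‖ ^ 2) * ‖fderiv ℝ u y‖ ^ 2) := by
    rw [hc']
    field_simp
  rw [e]
  have h4 : c * (∫ y : E, θ (‖y‖ ^ 2) * u y ^ 2) ≤
      c⁻¹ * ∫ y : E, η (‖y‖ ^ 2) * ‖fderiv ℝ u y‖ ^ 2 := by
    have : (n - 2) = 2 * c := by
      rw [hc']
      ring
    rw [this] at hI
    linarith
  calc (∫ y : E, θ (‖y‖ ^ 2) * u y ^ 2) = c⁻¹ * (c * ∫ y : E, θ (‖y‖ ^ 2) * u y ^ 2) := by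
        field_simp
    _ ≤ c⁻¹ * (c⁻¹ * ∫ y : E, η (‖y‖ ^ 2) * ‖fderiv ℝ u y‖ ^ 2) :=
        mul_le_mul_of_nonneg_left h4 (inv_nonneg.2 hcpos.le)

/-! ### The exterior Hardy inequality -/

/-- **Hardy's inequality outside a ball** (the `ℝⁿ` form, `n ≥ 3`, of the Hardy inequalities of
Dafermos–Rodnianski–Shlapentokh-Rothman, arXiv:1402.7034, §4.3, on Euclidean slices): for a real
inner product space `E` of dimension `n ≥ 3`, `u ∈ C¹_c(E)` and `R > 0`,
`∫_{‖y‖ > R} u²/‖y‖² ≤ (2/(n − 2))² ∫_{‖y‖ > R} ‖Du‖²`.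
[cite: DafermosRodnianskiShlapentokhrothman2014, §4.3] -/
theorem hardy_sq_integral_exterior_le {u : E → ℝ} (hu : ContDiff ℝ 1 u)
    (hc : HasCompactSupport u) {R : ℝ} (hR : 0 < R) (hn : 3 ≤ finrank ℝ E) :
    ∫ y in {y : E | R < ‖y‖}, u y ^ 2 / ‖y‖ ^ 2 ≤
      (2 / ((finrank ℝ E : ℝ) - 2)) ^ 2 * ∫ y in {y : E | R < ‖y‖}, ‖fderiv ℝ u y‖ ^ 2 := by
  have hn' : 2 < (finrank ℝ E : ℝ) := by exact_mod_cast hn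
  set S : Set E := {y | R < ‖y‖} with hS
  have hSm : MeasurableSet S := (isOpen_lt continuous_const continuous_norm).measurableSet
  have hyS : ∀ y, y ∈ S ↔ R < ‖y‖ := fun y ↦ Iff.rfl
  set C : ℝ := (2 / ((finrank ℝ E : ℝ) - 2)) ^ 2 with hC
  -- the cut-offs `η_k(s) = smoothTransition((k + 1)(s − R²))`
  obtain ⟨η, hη⟩ : ∃ η : ℕ → ℝ → ℝ,
      ∀ k, η k = fun s ↦ Real.smoothTransition ((k + 1) * (s - R ^ 2)) := ⟨_, fun _ ↦ rfl⟩
  have hηC : ∀ k, ContDiff ℝ 1 (η k) := fun k ↦ by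
    rw [hη k]
    exact Real.smoothTransition.contDiff.comp (contDiff_const.mul (contDiff_id.sub contDiff_const))
  have hηm : ∀ k, Monotone (η k) := fun k a b hab ↦ by
    rw [hη k]
    exact Real.smoothTransition.monotone (by gcongr)
  have hη1 : ∀ k s, η k s ≤ 1 := fun k s ↦ by
    rw [hη k]
    exact Real.smoothTransition.le_one _
  have hηnn : ∀ k s, 0 ≤ η k s := fun k s ↦ by
    rw [hη k]
    exact Real.smoothTransition.nonneg _
  have hη0 : ∀ k, ∀ s ≤ R ^ 2, η k s = 0 := fun k s hs ↦ by
    rw [hη k]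
    exact Real.smoothTransition.zero_of_nonpos
      (mul_nonpos_of_nonneg_of_nonpos (by positivity) (sub_nonpos.2 hs))
  have hηone : ∀ (k : ℕ) (s : ℝ), 1 ≤ ((k : ℝ) + 1) * (s - R ^ 2) → η k s = 1 := fun k s hs ↦ by
    rw [hη k]
    exact Real.smoothTransition.one_of_one_le hs
  have hηS : ∀ k y, y ∉ S → η k (‖y‖ ^ 2) = 0 := by
    intro k y hy
    refine hη0 k _ (pow_le_pow_left₀ (norm_nonneg _) ?_ 2)
    exact not_lt.1 (mt (hyS y).2 hy)
  have hSsq : ∀ y ∈ S, R ^ 2 < ‖y‖ ^ 2 := fun y hy ↦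
    pow_lt_pow_left₀ ((hyS y).1 hy) hR.le two_ne_zero
  -- the cut-off inequality for each `k`, with right side bounded by the exterior integral
  have huc : Continuous u := hu.continuous
  have hDc : Continuous (fderiv ℝ u) := hu.continuous_fderiv one_ne_zero
  have hK : IsCompact (tsupport u) := hc
  have hz : ∀ y ∉ tsupport u, u y = 0 := fun y hy ↦ image_eq_zero_of_notMem_tsupport hy
  have hDz : ∀ y ∉ tsupport u, fderiv ℝ u y = 0 := fun y hy ↦ fderiv_of_notMem_tsupport ℝ hy
  have hcs : ∀ {φ : E → ℝ}, (∀ y ∉ tsupport u, φ y = 0) → HasCompactSupport φ :=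
    fun h ↦ HasCompactSupport.intro hK h
  have hD2i : Integrable fun y ↦ ‖fderiv ℝ u y‖ ^ 2 :=
    ((continuous_norm.comp hDc).pow 2).integrable_of_hasCompactSupport
      (hcs fun y hy ↦ by simp [hDz y hy])
  have hbound : ∀ k, ∫ y, η k (‖y‖ ^ 2) * u y ^ 2 / ‖y‖ ^ 2 ≤ C * ∫ y in S, ‖fderiv ℝ u y‖ ^ 2 := by
    intro k
    refine (hardy_sq_integral_cutoff_le hu hc hR.ne' (hηC k) (hηm k) (hη0 k) hn').trans ?_
    refine mul_le_mul_of_nonneg_left ?_ (by positivity)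
    rw [← integral_indicator hSm]
    refine integral_mono ?_ (hD2i.indicator hSm) fun y ↦ ?_
    · refine hD2i.bdd_mul (c := 1) ?_ (ae_of_all _ fun y ↦ ?_)
      · exact ((hηC k).continuous.comp (continuous_norm.pow 2)).aestronglyMeasurable
      · rw [Real.norm_eq_abs, abs_of_nonneg (hηnn k _)]
        exact hη1 k _
    · by_cases hy : y ∈ S
      · rw [indicator_of_mem hy]
        exact mul_le_of_le_one_left (sq_nonneg _) (hη1 k _)
      · rw [indicator_of_notMem hy, hηS k y hy, zero_mul]
  -- monotone convergence `η_k(‖y‖²) u²/‖y‖² ↑ 1_S u²/‖y‖²`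
  have hFi : ∀ k, Integrable fun y : E ↦ η k (‖y‖ ^ 2) * u y ^ 2 / ‖y‖ ^ 2 := by
    intro k
    have hθC := contDiff_div_id_of_eq_zero (hηC k) hR.ne' (hη0 k)
    have : (fun y : E ↦ η k (‖y‖ ^ 2) * u y ^ 2 / ‖y‖ ^ 2) =
        fun y ↦ (η k (‖y‖ ^ 2) / ‖y‖ ^ 2) * u y ^ 2 := by
      funext y
      ring
    rw [this]
    exact ((hθC.continuous.comp (continuous_norm.pow 2)).mul (huc.pow 2))
      |>.integrable_of_hasCompactSupport (hcs fun y hy ↦ by simp [hz y hy])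
  have hGi : Integrable (S.indicator fun y : E ↦ u y ^ 2 / ‖y‖ ^ 2) := by
    rw [integrable_indicator_iff hSm]
    have hg : Integrable fun y : E ↦ (R ^ 2)⁻¹ * u y ^ 2 :=
      ((huc.pow 2).integrable_of_hasCompactSupport (hcs fun y hy ↦ by simp [hz y hy])).const_mul _
    refine Integrable.mono' hg.integrableOn ?_ (ae_restrict_of_forall_mem hSm fun y hy ↦ ?_)
    · exact ((huc.measurable.pow_const 2).div
        (continuous_norm.measurable.pow_const 2)).aestronglyMeasurable
    · rw [Real.norm_eq_abs, abs_of_nonneg (div_nonneg (sq_nonneg _) (sq_nonneg _)),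
        div_eq_inv_mul]
      have hRy : R ^ 2 ≤ ‖y‖ ^ 2 := (hSsq y hy).le
      have hR2 : 0 < R ^ 2 := by positivity
      exact mul_le_mul_of_nonneg_right ((inv_le_inv₀ (hR2.trans_le hRy) hR2).2 hRy)
        (sq_nonneg _)
  have hmono : ∀ᵐ y ∂(volume : Measure E),
      Monotone fun k ↦ η k (‖y‖ ^ 2) * u y ^ 2 / ‖y‖ ^ 2 := by
    refine ae_of_all _ fun y a b hab ↦ ?_
    refine div_le_div_of_nonneg_right (mul_le_mul_of_nonneg_right ?_ (sq_nonneg _)) (sq_nonneg _)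
    by_cases hy : y ∈ S
    · have hk : (a : ℝ) + 1 ≤ (b : ℝ) + 1 := by exact_mod_cast Nat.succ_le_succ hab
      have hRy := hSsq y hy
      rw [hη a, hη b]
      exact Real.smoothTransition.monotone (mul_le_mul_of_nonneg_right hk (by linarith))
    · rw [hηS a y hy, hηS b y hy]
  have hlim : ∀ᵐ y ∂(volume : Measure E), Tendsto (fun k ↦ η k (‖y‖ ^ 2) * u y ^ 2 / ‖y‖ ^ 2)
      atTop (𝓝 (S.indicator (fun y : E ↦ u y ^ 2 / ‖y‖ ^ 2) y)) := by
    refine ae_of_all _ fun y ↦ ?_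
    by_cases hy : y ∈ S
    · -- eventually `η_k(‖y‖²) = 1`
      have hpos : 0 < ‖y‖ ^ 2 - R ^ 2 := by linarith [hSsq y hy]
      obtain ⟨k₀, hk₀⟩ := exists_nat_ge (1 / (‖y‖ ^ 2 - R ^ 2))
      refine tendsto_atTop_of_eventually_const (i₀ := k₀) fun k hk ↦ ?_
      have h1 : 1 ≤ ((k : ℝ) + 1) * (‖y‖ ^ 2 - R ^ 2) := by
        rw [div_le_iff₀ hpos] at hk₀
        have : (k₀ : ℝ) ≤ k := by exact_mod_cast hk
        nlinarith
      rw [indicator_of_mem hy, hηone k _ h1, one_mul]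
    · have hG0 : S.indicator (fun y : E ↦ u y ^ 2 / ‖y‖ ^ 2) y = 0 := indicator_of_notMem hy _
      rw [hG0]
      refine tendsto_const_nhds.congr fun k ↦ ?_
      rw [hηS k y hy, zero_mul, zero_div]
  have hT := integral_tendsto_of_tendsto_of_monotone hFi hGi hmono hlim
  rw [integral_indicator hSm] at hT
  exact le_of_tendsto' hT fun k ↦ hbound k

end Literature.Analysis.Calculus

end
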